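import Mathlib.MeasureTheory.Integral.Pi
import Mathlib.MeasureTheory.Integral.DominatedConvergence
import Mathlib.Analysis.SpecialFunctions.Integrals.Basic
import Mathlib.Analysis.SpecialFunctions.Complex.Circle
import Mathlib.MeasureTheory.Integral.IntervalIntegral.Basic
import Mathlib.Tactic
import HarnessLib

/-!
# Coefficients of an absolutely convergent multiple Fourier series are bounded by its sup on the torus

The multivariable Cauchy estimate in the form used by Calegari–Dimitrov–Tang for the Cauchy bound
on the leading coefficient of the auxiliary function (arXiv:2408.15403, §6.5.3 eqs. (6.21)–(6.22);
arXiv:2109.09040, §2.5 eq. (CauchyBound)): writing the coefficient as a torus integral,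
`[𝐳^𝛎₀] H = ∫_{𝕋^d} H(𝐳) 𝐳^{−𝛎₀} μ_Haar(𝐳)`, and "estimating the integrand pointwise by the
supremum" gives `|[𝐳^𝛎₀] H| ≤ sup_{𝕋^d} |H|`. We prove this for every multiple Fourier /
power series `H(e(𝛉)) = Σ_𝛎 a_𝛎 e(𝛎·𝛉)` with absolutely summable coefficients (which covers
functions holomorphic on a neighbourhood of the closed unit polydisc and finite sums of products
of one-variable such functions, the case of CDT): orthogonality of characters on `[0,1]^d`
(`integral_echar`), the coefficient formula (`coeff_eq_integral`) and the bound
(`norm_coeff_le_of_bound`).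

No named facts.

## References

* [CalegariDimitrovTang2024] arXiv:2408.15403, §6.5.3 eqs. (6.21)–(6.22).
* [CalegariDimitrovTang2025] arXiv:2109.09040, §2.5 (the Cauchy upper bound).
-/

noncomputable section

open MeasureTheory Set Complex

namespace Literature.Analysis.Fourier

namespace TorusCoeff

variable {d : ℕ}

/-- The uniform probability measure on `[0,1)^d` (the torus `𝕋^d` in angular coordinates).
[folklore] -/
def cube (d : ℕ) : Measure (Fin d → ℝ) :=
  Measure.pi fun _ : Fin d => (volume.restrict (Ico (0 : ℝ) 1))

/-- `volume|[0,1)` is a probability measure. [folklore] -/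
instance : IsProbabilityMeasure (volume.restrict (Ico (0 : ℝ) 1)) := ⟨by simp [Real.volume_Ico]⟩

/-- The cube measure is a probability measure. [folklore] -/
instance (d : ℕ) : IsProbabilityMeasure (cube d) := by unfold cube; infer_instance

/-- The character `e(𝐤·𝛉) = Π_s exp(2πi k_s θ_s)` (`𝐤 ∈ ℤ^d`). [folklore] -/
def echar (k : Fin d → ℤ) (θ : Fin d → ℝ) : ℂ := ∏ s, Complex.exp (2 * Real.pi * I * k s * θ s)

/-- `|e(𝐤·𝛉)| = 1`. [folklore] -/
theorem norm_echar (k : Fin d → ℤ) (θ : Fin d → ℝ) : ‖echar k θ‖ = 1 := by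
  unfold echar
  rw [norm_prod]
  refine Finset.prod_eq_one fun s _ => ?_
  rw [show (2 * Real.pi * I * k s * θ s : ℂ) = ((2 * Real.pi * k s * θ s : ℝ) : ℂ) * I by push_cast; ring]
  exact Complex.norm_exp_ofReal_mul_I _

/-- `echar` is continuous, hence measurable. [folklore] -/
theorem continuous_echar (k : Fin d → ℤ) : Continuous (echar k) := by
  unfold echar
  refine continuous_finsetProd _ fun s _ => ?_
  exact Complex.continuous_exp.comp (continuous_const.mul (Complex.continuous_ofReal.comp (continuous_apply s)))

/-- One-dimensional orthogonality: `∫₀¹ e(kθ) dθ = [k = 0]`. [folklore] -/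
theorem integral_exp_int (k : ℤ) :
    ∫ θ in Ico (0 : ℝ) 1, Complex.exp (2 * Real.pi * I * k * θ) = if k = 0 then 1 else 0 := by
  rw [integral_Ico_eq_integral_Ioc, ← intervalIntegral.integral_of_le zero_le_one]
  split_ifs with hk
  · subst hk; simp
  · have hc : (2 * Real.pi * I * k : ℂ) ≠ 0 := by
      have : (k : ℂ) ≠ 0 := by exact_mod_cast hk
      have hπ : (Real.pi : ℂ) ≠ 0 := by exact_mod_cast Real.pi_ne_zero
      simp [hπ, Complex.I_ne_zero, this]
    rw [integral_exp_mul_complex hc]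
    have h1 : Complex.exp (2 * Real.pi * I * k * (1 : ℝ)) = 1 := by
      rw [show (2 * Real.pi * I * k * ((1 : ℝ) : ℂ) : ℂ) = (k : ℂ) * (2 * Real.pi * I) by push_cast; ring]
      exact Complex.exp_int_mul_two_pi_mul_I k
    have h0 : Complex.exp (2 * Real.pi * I * k * (0 : ℝ)) = 1 := by simp
    rw [h1, h0, sub_self, zero_div]

/-- **Orthogonality of characters on `[0,1)^d`**: `∫ e(𝐤·𝛉) d𝛉 = [𝐤 = 0]`. [folklore] -/
theorem integral_echar (k : Fin d → ℤ) : ∫ θ, echar k θ ∂(cube d) = if k = 0 then 1 else 0 := by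
  unfold echar cube
  rw [integral_fintype_prod_eq_prod (fun s (x : ℝ) => Complex.exp (2 * Real.pi * I * k s * x))]
  simp_rw [integral_exp_int]
  split_ifs with hk
  · subst hk; simp
  · obtain ⟨s, hs⟩ : ∃ s, k s ≠ 0 := by
      by_contra h; push Not at h; exact hk (funext h)
    exact Finset.prod_eq_zero (Finset.mem_univ s) (if_neg hs)

/-- The multiple Fourier series `H(𝛉) = Σ_𝛎 a_𝛎 e(𝛎·𝛉)` of an absolutely summable coefficient
family indexed by `ℕ^d` (a multivariate power series restricted to the torus). [folklore] -/
def fseries (a : (Fin d → ℕ) → ℂ) (θ : Fin d → ℝ) : ℂ := ∑' ν, a ν * echar (fun s => (ν s : ℤ)) θ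

/-- **Coefficient formula**: `a_{𝛎₀} = ∫_{[0,1)^d} H(𝛉) e(−𝛎₀·𝛉) d𝛉` for absolutely summable `a`.
[cite: CalegariDimitrovTang2024, §6.5.3 eq. (6.21)] -/
theorem coeff_eq_integral (a : (Fin d → ℕ) → ℂ) (ha : Summable fun ν => ‖a ν‖) (ν₀ : Fin d → ℕ) :
    a ν₀ = ∫ θ, fseries a θ * echar (fun s => -(ν₀ s : ℤ)) θ ∂(cube d) := by
  have hmul : ∀ θ, fseries a θ * echar (fun s => -(ν₀ s : ℤ)) θ =
      ∑' ν, a ν * echar (fun s => (ν s : ℤ) - ν₀ s) θ := by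
    intro θ
    rw [fseries, ← tsum_mul_right]
    refine tsum_congr fun ν => ?_
    rw [mul_assoc]
    congr 1
    unfold echar
    rw [← Finset.prod_mul_distrib]
    refine Finset.prod_congr rfl fun s _ => ?_
    rw [← Complex.exp_add]
    congr 1
    push_cast; ring
  simp_rw [hmul]
  -- swap sum and integral
  have hint : ∀ ν, Integrable (fun θ => a ν * echar (fun s => (ν s : ℤ) - ν₀ s) θ) (cube d) := by
    intro ν
    refine (Integrable.const_mul ?_ _)
    refine ⟨(continuous_echar _).aestronglyMeasurable, ?_⟩
    exact HasFiniteIntegral.of_bounded (C := 1) (ae_of_all _ fun θ => (norm_echar _ θ).le)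
  have hsum : Summable fun ν => ∫ θ, ‖a ν * echar (fun s => (ν s : ℤ) - ν₀ s) θ‖ ∂(cube d) := by
    refine ha.congr fun ν => ?_
    simp_rw [norm_mul, norm_echar, mul_one]
    rw [integral_const, probReal_univ, one_smul]
  rw [← integral_tsum_of_summable_integral_norm hint hsum]
  simp_rw [integral_const_mul, integral_echar]
  rw [tsum_eq_single ν₀]
  · rw [if_pos (by funext s; simp), mul_one]
  · intro ν hν
    rw [if_neg, mul_zero]
    intro h
    apply hν
    funext s
    have := congrFun h s
    simp only [Pi.zero_apply, sub_eq_zero, Nat.cast_inj] at this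
    exact this

/-- **The Cauchy estimate on the torus**: if `|H| ≤ B` on the torus then every coefficient has
`|a_{𝛎₀}| ≤ B`. [cite: CalegariDimitrovTang2024, §6.5.3 eq. (6.22) ("estimating the latter
integrand pointwise by the supremum"); CalegariDimitrovTang2025, §2.5 eq. (CauchyBound)] -/
theorem norm_coeff_le_of_bound (a : (Fin d → ℕ) → ℂ) (ha : Summable fun ν => ‖a ν‖) (ν₀ : Fin d → ℕ)
    {B : ℝ} (hB : ∀ θ : Fin d → ℝ, (∀ s, θ s ∈ Ico (0 : ℝ) 1) → ‖fseries a θ‖ ≤ B) :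
    ‖a ν₀‖ ≤ B := by
  rw [coeff_eq_integral a ha ν₀]
  have hB0 : 0 ≤ B := by
    have := hB (fun _ => 0) fun _ => ⟨le_rfl, zero_lt_one⟩
    exact (norm_nonneg _).trans this
  refine (norm_integral_le_integral_norm _).trans ?_
  have hae : ∀ᵐ θ ∂(cube d), ‖fseries a θ * echar (fun s => -(ν₀ s : ℤ)) θ‖ ≤ B := by
    have hmem : ∀ᵐ θ ∂(cube d), ∀ s, θ s ∈ Ico (0 : ℝ) 1 := by
      have hS : (cube d) (Set.pi Set.univ fun _ : Fin d => Ico (0 : ℝ) 1) = 1 := by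
        unfold cube
        rw [Measure.pi_pi]
        simp [Measure.restrict_apply measurableSet_Ico, Real.volume_Ico]
      have hcompl : (cube d) (Set.pi Set.univ fun _ : Fin d => Ico (0 : ℝ) 1)ᶜ = 0 := by
        rw [measure_compl (MeasurableSet.univ_pi fun _ => measurableSet_Ico) (measure_ne_top _ _), hS,
          measure_univ, tsub_self]
      rw [ae_iff]
      refine measure_mono_null (fun θ hθ => ?_) hcompl
      simp only [Set.mem_setOf_eq, not_forall] at hθ
      simp only [Set.mem_compl_iff, Set.mem_pi, Set.mem_univ, true_implies, not_forall]
      exact hθ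
    filter_upwards [hmem] with θ hθ
    rw [norm_mul, norm_echar, mul_one]
    exact hB θ hθ
  calc ∫ θ, ‖fseries a θ * echar (fun s => -(ν₀ s : ℤ)) θ‖ ∂(cube d) ≤ ∫ _θ, B ∂(cube d) :=
        integral_mono_of_nonneg (ae_of_all _ fun θ => norm_nonneg _) (integrable_const B) hae
    _ = B := by rw [integral_const, probReal_univ, one_smul]

end TorusCoeff

end Literature.Analysis.Fourier
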